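import Mathlib
import HarnessLib

/-!
# CompactSemisimpleUniversalCover

Topic `Literature/RepresentationTheory/CompactGroups`. Named literature fact (unproved here): Weyl's covering
theorem for compact semisimple Lie groups, stated over Mathlib vocabulary (faithful continuous unitary matrix
representations in place of a Lie-group structure, as everywhere in this directory).
Sources: BrockerTomDieck1985, Sepanski2007.

* `Literature.RepresentationTheory.CompactGroups.CompactSemisimpleUniversalCover`
-/

namespace Literature.RepresentationTheory.CompactGroups

/-- **Weyl's covering theorem (universal cover of a compact semisimple Lie group).** Let `G` be a compact
connected topological group with a faithful continuous unitary matrix representation (so `G` is a closed subgroup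
of `U(N)`, a compact Lie group: Bröcker–tom Dieck III (4.1) with I (3.11)) in which every closed connected abelian
normal subgroup is trivial (equivalently the identity component of the centre is trivial, i.e. `G` is SEMISIMPLE,
V (3.13) / Remark (7.13)). Then the universal covering group `π : G̃ → G` is a COMPACT simply connected topological
group, `π` is a continuous surjective homomorphism with FINITE kernel (`≅ π₁(G)`; Weyl's theorem, V Thm (7.1) with
Remark (7.13) (i)⇔(iii)⇔(iv); Sepanski Thm 1.22, Cor 6.33(a)), and `G̃`, being a compact Lie group, again has a
faithful continuous unitary matrix representation (III (4.1), Peter–Weyl). Stated as an existence claim over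
Mathlib's vocabulary (no `LieGroup` structure is asserted); the trivial group is allowed (`G̃ = G`). Consumed by
`Summits/QuantumFields/YangMills/Theorems/ConvexGribovBodyNonSimplyConnectedLatticeGapStubUniversalCoverAux1.lean`
(`stub_universalCover_of_cover`, whose hypothesis is this statement verbatim).
[cite: BrockerTomDieck1985, V Thm (7.1) and Remark (7.13); III (4.1)] [cite: Sepanski2007, Thm 1.22 and Cor 6.33(a)]
[file RepresentationTheory/CompactGroups/CompactSemisimpleUniversalCover] -/
def CompactSemisimpleUniversalCover : Prop :=
  ∀ (G : Type) [Group G] [TopologicalSpace G] [IsTopologicalGroup G] [CompactSpace G] [ConnectedSpace G]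
    (N : ℕ) (ρ : G →* Matrix (Fin N) (Fin N) ℂ), Continuous ρ → Function.Injective ρ →
    (∀ g, ρ g ∈ Matrix.unitaryGroup (Fin N) ℂ) →
    (∀ A : Subgroup G, A.Normal → IsClosed (A : Set G) → IsPreconnected (A : Set G) →
      (∀ a ∈ A, ∀ b ∈ A, a * b = b * a) → A = ⊥) →
    ∃ (H : Type) (_ : Group H) (_ : TopologicalSpace H) (_ : IsTopologicalGroup H) (_ : CompactSpace H)
      (π : H →* G), SimplyConnectedSpace H ∧ Continuous π ∧ Function.Surjective π ∧
      (π.ker : Set H).Finite ∧ ∃ (M : ℕ) (σ : H →* Matrix (Fin M) (Fin M) ℂ), Continuous σ ∧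
      Function.Injective σ ∧ ∀ h, σ h ∈ Matrix.unitaryGroup (Fin M) ℂ

end Literature.RepresentationTheory.CompactGroups
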